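import Literature.Probability.Percolation.BoxCrossingSteps
import Literature.Probability.Percolation.LatticeSymmetry
import Literature.Probability.Percolation.IsoradialProofs
import Literature.Probability.Percolation.BernoulliPercolation
import HarnessLib

/-!
# Inputs of the half-plane arm gluing for the diagonal half-plane `{v₀ + v₁ ≥ 0}` of `ℤ²` at `p = 1/2`

Topic `Literature/Probability/Percolation`; proofs only (no definition, no named fact). The files
`HalfPlaneUCatch.lean`, `HalfPlaneCrossingGluing.lean`, `HalfPlaneOneArmQuasiMultiplicativity.lean`
are written for abstract integer coordinates `X, Y : ℤ² → ℤ`; this file discharges their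
hypotheses for the DIAGONAL coordinates `X = col = v₀ - v₁`, `Y = hgtOf = v₀ + v₁`
(`TrackExchange`, the index coordinates of the isoradial square lattice `G_{0,π/2}` of
Grimmett–Manolescu 2014, §4.6, drawn by `zDia`):

* `diag_X_le`, `diag_Y_le`, `diag_injective`, `diag_re`, `diag_im`;
* `diag_rswLR` — **RSW for long turned boxes at `p = 1/2`**: uniform lower bounds for the fuzzy
  left–right crossing events of the turned `k m × m` boxes (`embRectCrossing` for `zDia`) at all
  integer positions, for every `k ≥ 2`: the ratio-`2` bounds of `DiagonalBoxCrossing.lean`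
  (`diag_lr_lower`, `diag_tb_lower`) chained by Harris–FKG (`Chaining.prod_le_measureReal_chain`,
  Grimmett 1999, §11.7, Fig. 11.27; Grimmett–Manolescu 2014, §2.3);
* `diag_rswTB` — the same for top–bottom crossings of `m × k m` turned boxes, by the reflection
  `(v₀, v₁) ↦ (v₀, -v₁)` of `ℤ²`, which exchanges `col` and `hgtOf`;
* `real_diagArm_eq` — the DIAGONAL half-plane one-arm probability of the crux line
  (`0 ↔ {s = -n} ∪ {d = ±n}` inside `{s ≤ 1, s ≥ -n, |d| ≤ n}`, `s = v₀ + v₁`, `d = v₀ - v₁`) equals,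
  by the lattice symmetry `v ↦ (1 - v₀, -v₁)`, the probability of the abstract arm event based at
  `(1, 0)` in the half-plane `{hgtOf ≥ 0}`.

## References

* G. R. Grimmett, I. Manolescu, PTRF 159 (2014), §2.3, §6.2. [GrimmettManolescu2014Isoradial]
* G. Grimmett, *Percolation* (1999), §11.7. [GrimmettPercolation1999]
-/

noncomputable section

namespace Literature.Probability.Percolation

open MeasureTheory Set LatticeModels Complex Real
open TrackExchange

namespace HalfPlaneArm

/-! ### The coordinates -/

/-- `col` moves by at most one along an edge. [folklore] -/
theorem diag_X_le (u v : Site 2) (h : (zdGraph 2).Adj u v) : col v ≤ col u + 1 := col_le_of_adj u v h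

/-- `hgtOf` moves by at most one along an edge. [folklore] -/
theorem diag_Y_le (u v : Site 2) (h : (zdGraph 2).Adj u v) : hgtOf v ≤ hgtOf u + 1 := hgtOf_le_of_adj u v h

/-- A site is determined by its diamond coordinates. [folklore] -/
theorem diag_injective : Function.Injective fun v : Site 2 => (col v, hgtOf v) := by
  intro v w h
  simp only [Prod.mk.injEq, col, hgtOf] at h
  funext i
  fin_cases i
  · show v 0 = w 0; omega
  · show v 1 = w 1; omega

/-- The diamond coordinates are the real and imaginary parts of the drawing `G_{0,π/2}`. [folklore] -/
theorem diag_re (v : Site 2) : ((gmEmbedding (fun _ => (0 : ℝ)) (fun _ => π / 2)).z v).re = 1 * ((col v : ℤ) : ℝ) := by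
  rw [zDia_eq_gmEmbedding_z, zDia_re, one_mul]

/-- The diamond coordinates are the real and imaginary parts of the drawing `G_{0,π/2}`. [folklore] -/
theorem diag_im (v : Site 2) : ((gmEmbedding (fun _ => (0 : ℝ)) (fun _ => π / 2)).z v).im = 1 * ((hgtOf v : ℤ) : ℝ) := by
  rw [zDia_eq_gmEmbedding_z, zDia_im, one_mul]

/-! ### Russo–Seymour–Welsh inputs at `p = 1/2` -/

/-- The canonical measure of `G_{0, π/2}` is critical bond percolation. [cite: GrimmettManolescu2014Isoradial, §6.2] -/
theorem Pgm_zero_eq : prodBernoulli (Percolation.gmWeight (fun _ => (0 : ℝ)) (fun _ => (0 : ℝ) + π / 2)) =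
    bondPercolation (zdGraph 2) half :=
  (Pgm_base 0).trans isoradialPercolation_square_eq_holds

/-- **RSW input, left–right, diagonal orientation**: for every `k ≥ 2` there are `c > 0`, `m₀`
such that the fuzzy turned box `{A - 2 ≤ col ≤ A + km + 2} × {B ≤ hgtOf ≤ B + m}` is crossed by an
open path from `{col ≤ A}` to `{A + km ≤ col}` with probability `≥ c` for all `m ≥ m₀` and all
`(A, B)` (chain `k - 1` turned `2m × m` crossings through `k - 2` turned `m × 2m` ones).
[cite: GrimmettManolescu2014Isoradial, §2.3 (Harris–FKG reduction) with §6.2] -/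
theorem diag_rswLR : ∀ k : ℕ, 2 ≤ k → ∃ c : ℝ, 0 < c ∧ ∃ m₀ : ℕ, ∀ m : ℕ, m₀ ≤ m → ∀ A B : ℤ,
    c ≤ (bondPercolation (zdGraph 2) half).real
      (openCrossing {v : Site 2 | A - 2 ≤ col v ∧ col v ≤ A + (k : ℤ) * m + 2 ∧ B ≤ hgtOf v ∧ hgtOf v ≤ B + (m : ℤ)}
        {v : Site 2 | col v ≤ A} {v : Site 2 | A + (k : ℤ) * m ≤ col v}) := by
  intro k hk
  obtain ⟨c₁, hc₁, m₁, h₁⟩ := diag_lr_lower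
  obtain ⟨c₂, hc₂, m₂, h₂⟩ := diag_tb_lower
  refine ⟨c₁ ^ (k - 1) * c₂ ^ (k - 2), by positivity, max m₁ m₂ + 1, fun m hm A B => ?_⟩
  have hm₁ : m₁ ≤ m := le_trans (le_max_left _ _) (Nat.le_of_succ_le hm)
  have hm₂ : m₂ ≤ m := le_trans (le_max_right _ _) (Nat.le_of_succ_le hm)
  have hm0 : 0 < m := by omega
  set a : ℕ → ℤ := fun j => A + j * m with ha
  have key := prod_le_measureReal_chain (a := a) (B := B) (B' := B) (w := 2 * m) (c := m) (h := m) (h' := 2 * m)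
    (fun _ => (0 : ℝ)) (fun _ => (0 : ℝ) + π / 2) hm0 hm0 (by omega) (fun j => by simp only [ha]; push_cast; nlinarith)
    (fun j => by simp only [ha]; push_cast; nlinarith) le_rfl (by omega) (k - 2)
  rw [Pgm_zero_eq] at key
  -- the factors
  have eH : ∀ j, c₁ ≤ (bondPercolation (zdGraph 2) half).real (hBox a B (2 * m) m j) := fun j => by
    have := h₁ m hm₁ (a j) B
    rw [isoradialPercolation_square_eq_holds] at this
    simpa [hBox] using this
  have eV : ∀ j, c₂ ≤ (bondPercolation (zdGraph 2) half).real (vBox a B m (2 * m) j) := fun j => by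
    have := h₂ m hm₂ (a (j + 1)) B
    rw [isoradialPercolation_square_eq_holds] at this
    simpa [vBox] using this
  have lhs : c₁ ^ (k - 1) * c₂ ^ (k - 2) ≤
      (∏ j ∈ Finset.range (k - 2 + 1), (bondPercolation (zdGraph 2) half).real (hBox a B (2 * m) m j)) *
        ∏ j ∈ Finset.range (k - 2), (bondPercolation (zdGraph 2) half).real (vBox a B m (2 * m) j) := by
    have e1 : c₁ ^ (k - 1) ≤ ∏ j ∈ Finset.range (k - 2 + 1), (bondPercolation (zdGraph 2) half).real (hBox a B (2 * m) m j) := by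
      rw [show k - 1 = k - 2 + 1 by omega, ← Finset.card_range (k - 2 + 1), ← Finset.prod_const, Finset.card_range]
      exact Finset.prod_le_prod (fun _ _ => hc₁.le) fun j _ => eH j
    have e2 : c₂ ^ (k - 2) ≤ ∏ j ∈ Finset.range (k - 2), (bondPercolation (zdGraph 2) half).real (vBox a B m (2 * m) j) := by
      rw [← Finset.card_range (k - 2), ← Finset.prod_const, Finset.card_range]
      exact Finset.prod_le_prod (fun _ _ => hc₂.le) fun j _ => eV j
    exact mul_le_mul e1 e2 (by positivity) (Finset.prod_nonneg fun _ _ => measureReal_nonneg)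
  refine (lhs.trans key).trans (measureReal_mono (openCrossing_mono ?_ ?_ ?_) (measure_ne_top _ _))
  · intro v hv
    obtain ⟨⟨hv1, hv2⟩, hv3, hv4⟩ := hv
    simp only [ha, re_zDia_sub_int, im_zDia_sub_int] at hv1 hv2 hv3 hv4
    simp only [mem_setOf_eq]
    have hw : ((A + ((k - 2 : ℕ) : ℤ) * m + (2 * m : ℕ) - (A + ((0 : ℕ) : ℤ) * m) : ℤ) : ℝ) = (k : ℝ) * m := by
      push_cast
      have : ((k - 2 : ℕ) : ℝ) = k - 2 := by rw [Nat.cast_sub hk]; norm_num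
      rw [this]; ring
    rw [hw] at hv2
    push_cast at hv1 hv2 hv3 hv4
    refine ⟨?_, ?_, ?_, ?_⟩
    · have : ((A - 2 : ℤ) : ℝ) ≤ col v := by push_cast; linarith
      exact_mod_cast this
    · have : (col v : ℝ) ≤ ((A + k * m + 2 : ℤ) : ℝ) := by push_cast; linarith
      exact_mod_cast this
    · have : ((B : ℤ) : ℝ) ≤ hgtOf v := by linarith
      exact_mod_cast this
    · have : (hgtOf v : ℝ) ≤ ((B + m : ℤ) : ℝ) := by push_cast; linarith
      exact_mod_cast this
  · intro v hv
    have hv' : (zDia v - (((a 0 : ℤ) : ℂ) + ((B : ℤ) : ℂ) * I)).re ≤ 0 := hv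
    simp only [ha, re_zDia_sub_int] at hv'
    push_cast at hv'
    simp only [mem_setOf_eq]
    have : (col v : ℝ) ≤ A := by linarith
    exact_mod_cast this
  · intro v hv
    have hv' : ((A + ((k - 2 : ℕ) : ℤ) * m + (2 * m : ℕ) - (A + ((0 : ℕ) : ℤ) * m) : ℤ) : ℝ) ≤
        (zDia v - (((a 0 : ℤ) : ℂ) + ((B : ℤ) : ℂ) * I)).re := hv
    simp only [ha, re_zDia_sub_int] at hv'
    push_cast at hv'
    have e : ((k - 2 : ℕ) : ℝ) = k - 2 := by rw [Nat.cast_sub hk]; norm_num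
    rw [e] at hv'
    simp only [mem_setOf_eq]
    have : ((A + k * m : ℤ) : ℝ) ≤ col v := by push_cast; linarith
    exact_mod_cast this

/-! ### Top–bottom crossings by reflection -/

/-- The reflection `(v₀, v₁) ↦ (v₀, -v₁)` exchanges the diamond coordinates. [folklore] -/
theorem col_reflectIso_one (v : Site 2) : col (reflectIso (1 : Fin 2) v) = hgtOf v := by
  simp only [col, hgtOf, reflectIso_apply_same, reflectIso_apply_of_ne (show (0 : Fin 2) ≠ 1 by decide)]
  ring

/-- The reflection `(v₀, v₁) ↦ (v₀, -v₁)` exchanges the diamond coordinates. [folklore] -/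
theorem hgtOf_reflectIso_one (v : Site 2) : hgtOf (reflectIso (1 : Fin 2) v) = col v := by
  simp only [col, hgtOf, reflectIso_apply_same, reflectIso_apply_of_ne (show (0 : Fin 2) ≠ 1 by decide)]
  ring

/-- The reflection is an involution. [folklore] -/
theorem reflectIso_one_reflectIso_one (v : Site 2) : reflectIso (1 : Fin 2) (reflectIso (1 : Fin 2) v) = v := by
  funext i
  fin_cases i
  · show reflectIso (1 : Fin 2) (reflectIso (1 : Fin 2) v) 0 = v 0
    rw [reflectIso_apply_of_ne (show (0 : Fin 2) ≠ 1 by decide),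
      reflectIso_apply_of_ne (show (0 : Fin 2) ≠ 1 by decide)]
  · show reflectIso (1 : Fin 2) (reflectIso (1 : Fin 2) v) 1 = v 1
    rw [reflectIso_apply_same, reflectIso_apply_same, neg_neg]

/-- Images under the reflection of sets given by the diamond coordinates. [folklore] -/
theorem image_reflectIso_one (P : ℤ → ℤ → Prop) :
    (reflectIso (1 : Fin 2) : Site 2 → Site 2) '' {v : Site 2 | P (col v) (hgtOf v)} =
      {v : Site 2 | P (hgtOf v) (col v)} := by
  ext v
  constructor
  · rintro ⟨w, hw, rfl⟩
    simp only [mem_setOf_eq, col_reflectIso_one, hgtOf_reflectIso_one] at hw ⊢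
    exact hw
  · intro hv
    refine ⟨reflectIso (1 : Fin 2) v, ?_, reflectIso_one_reflectIso_one v⟩
    simp only [mem_setOf_eq, col_reflectIso_one, hgtOf_reflectIso_one]
    exact hv

/-- **RSW input, top–bottom, diagonal orientation**: the reflection `(v₀, v₁) ↦ (v₀, -v₁)` turns
the fuzzy turned `m × km` box crossed from `{hgtOf ≤ B}` to `{B + km ≤ hgtOf}` into the fuzzy
turned `km × m` box of `diag_rswLR` with the coordinates exchanged.
[cite: GrimmettManolescu2014Isoradial, §2.3 (Harris–FKG reduction) with §6.2] -/
theorem diag_rswTB : ∀ k : ℕ, 2 ≤ k → ∃ c : ℝ, 0 < c ∧ ∃ m₀ : ℕ, ∀ m : ℕ, m₀ ≤ m → ∀ A B : ℤ,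
    c ≤ (bondPercolation (zdGraph 2) half).real
      (openCrossing {v : Site 2 | A ≤ col v ∧ col v ≤ A + (m : ℤ) ∧ B - 2 ≤ hgtOf v ∧ hgtOf v ≤ B + (k : ℤ) * m + 2}
        {v : Site 2 | hgtOf v ≤ B} {v : Site 2 | B + (k : ℤ) * m ≤ hgtOf v}) := by
  intro k hk
  obtain ⟨c, hc, m₀, h⟩ := diag_rswLR k hk
  refine ⟨c, hc, m₀, fun m hm A B => (h m hm B A).trans (le_of_eq ?_)⟩
  rw [← bondPercolation_real_image (reflectIso (1 : Fin 2)) half]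
  congr 2
  · rw [image_reflectIso_one (fun c h => B - 2 ≤ c ∧ c ≤ B + (k : ℤ) * m + 2 ∧ A ≤ h ∧ h ≤ A + (m : ℤ))]
    ext v; simp only [mem_setOf_eq]; tauto
  · exact image_reflectIso_one (fun c _ => c ≤ B)
  · exact image_reflectIso_one (fun c _ => B + (k : ℤ) * m ≤ c)

/-- `openCrossing` is monotone in the region and in the two targets read inside the region
(local copy of `HalfPlaneArm.openCrossing_mono'`). [folklore] -/
theorem openCrossing_mono'' {V : Type*} {S S' A A' B B' : Set V} (hS : S ⊆ S')
    (hA : ∀ x ∈ A, x ∈ S → x ∈ A') (hB : ∀ y ∈ B, y ∈ S → y ∈ B') :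
    (openCrossing S A B : Set (BondConfig V)) ⊆ openCrossing S' A' B' := by
  rintro ω ⟨x, hx, y, hy, hxy⟩
  exact ⟨x, hA x hx hxy.1, y, hB y hy hxy.2.1, openConnIn_mono hS _ _ hxy⟩

/-! ### The diagonal one-arm event of the crux line -/

/-- The lattice symmetry `v ↦ (1 - v₀, -v₁)` (point reflection followed by a unit shift); it maps
the half-plane `{v₀ + v₁ ≤ 1}` onto `{hgtOf ≥ 0}`, with `hgtOf ∘ ψ = 1 - (v₀ + v₁)`,
`col ∘ ψ = 1 - (v₀ - v₁)`. [folklore] -/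
theorem psi_apply (v : Site 2) :
    ((zdSignedPermIso (1 : Equiv.Perm (Fin 2)) (fun _ : Fin 2 => (-1 : ℤˣ))).trans (zdShiftIso ![1, 0])) v =
      ![1 - v 0, -v 1] := by
  funext i
  show (zdShiftIso ![1, 0]) (zdSignedPermIso 1 (fun _ : Fin 2 => (-1 : ℤˣ)) v) i = _
  have e : ∀ i, (Equiv.symm (1 : Equiv.Perm (Fin 2))) i = i := fun i => rfl
  rw [zdShiftIso_apply, zdSignedPermIso_apply]
  fin_cases i
  · simp [e]; ring
  · simp [e]

/-- **The diagonal half-plane one-arm probability in the abstract form.** For `n : ℕ`, the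
probability that `0` is joined inside `{v₀ + v₁ ≤ 1, -n ≤ v₀ + v₁, |v₀ - v₁| ≤ n}` to
`{v₀ + v₁ = -n} ∪ {v₀ - v₁ = ±n}` equals the probability of the open crossing, inside
`{0 ≤ hgtOf, max |col - col (1,0)| (hgtOf - hgtOf (1,0)) ≤ n}`, from `{(1, 0)}` to
`{max |col - col (1,0)| (hgtOf - hgtOf (1,0)) = n}` (the symmetry `v ↦ (1 - v₀, -v₁)` of `ℤ²`
and `P_{1/2}`-invariance, `bondPercolation_real_image`). [folklore] -/
theorem real_diagArm_eq (n : ℕ) :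
    (bondPercolation (zdGraph 2) half).real
      {ω : BondConfig (Site 2) | ∃ y : Site 2, (y 0 + y 1 = -(n : ℤ) ∨ y 0 - y 1 = (n : ℤ) ∨ y 0 - y 1 = -(n : ℤ)) ∧
        ω ∈ openConnIn {v : Site 2 | v 0 + v 1 ≤ 1 ∧ -(n : ℤ) ≤ v 0 + v 1 ∧ -(n : ℤ) ≤ v 0 - v 1 ∧ v 0 - v 1 ≤ n} 0 y} =
    (bondPercolation (zdGraph 2) half).real
      (openCrossing {v : Site 2 | 0 ≤ hgtOf v ∧ max |col v - col ![1, 0]| (hgtOf v - hgtOf ![1, 0]) ≤ n} {![1, 0]}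
        {v : Site 2 | max |col v - col ![1, 0]| (hgtOf v - hgtOf ![1, 0]) = n}) := by
  set ψ := (zdSignedPermIso (1 : Equiv.Perm (Fin 2)) (fun _ : Fin 2 => (-1 : ℤˣ))).trans (zdShiftIso ![1, 0]) with hψ
  set S : Set (Site 2) := {v : Site 2 | v 0 + v 1 ≤ 1 ∧ -(n : ℤ) ≤ v 0 + v 1 ∧ -(n : ℤ) ≤ v 0 - v 1 ∧ v 0 - v 1 ≤ n}
    with hS
  set T : Set (Site 2) := {y : Site 2 | y 0 + y 1 = -(n : ℤ) ∨ y 0 - y 1 = (n : ℤ) ∨ y 0 - y 1 = -(n : ℤ)} with hT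
  have hc1 : col ![1, 0] = 1 := by simp [col]
  have hh1 : hgtOf ![1, 0] = 1 := by simp [hgtOf]
  have hψcol : ∀ v, col (ψ v) = 1 - (v 0 - v 1) := fun v => by rw [hψ, psi_apply]; simp [col]; ring
  have hψhgt : ∀ v, hgtOf (ψ v) = 1 - (v 0 + v 1) := fun v => by rw [hψ, psi_apply]; simp [hgtOf]; ring
  have hψψ : ∀ v, ψ (ψ v) = v := fun v => by
    rw [hψ, psi_apply, psi_apply]
    funext i; fin_cases i <;> simp
  -- Step 1: the event is an open crossing event
  have e1 : {ω : BondConfig (Site 2) | ∃ y : Site 2, (y 0 + y 1 = -(n : ℤ) ∨ y 0 - y 1 = (n : ℤ) ∨ y 0 - y 1 = -(n : ℤ)) ∧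
      ω ∈ openConnIn S 0 y} = openCrossing S {0} T := by
    ext ω
    simp only [mem_setOf_eq, mem_openCrossing_iff, mem_singleton_iff, exists_eq_left]
    constructor
    · rintro ⟨y, hy, h⟩; exact ⟨y, hy, h⟩
    · rintro ⟨y, hy, h⟩; exact ⟨y, hy, h⟩
  rw [e1, ← bondPercolation_real_image ψ half S {0} T]
  -- Step 2: identify the image sets
  have eS : ψ '' S = {v : Site 2 | 0 ≤ hgtOf v ∧ max |col v - col ![1, 0]| (hgtOf v - hgtOf ![1, 0]) ≤ n} := by
    ext v
    rw [hc1, hh1]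
    constructor
    · rintro ⟨w, hw, rfl⟩
      obtain ⟨a1, a2, a3, a4⟩ := hw
      simp only [mem_setOf_eq, hψcol, hψhgt, max_le_iff, abs_le]
      omega
    · intro hv
      refine ⟨ψ v, ?_, hψψ v⟩
      obtain ⟨a1, a2⟩ := hv
      rw [max_le_iff, abs_le] at a2
      simp only [hS, mem_setOf_eq]
      have e0 : (ψ v) 0 = 1 - v 0 := by rw [hψ, psi_apply]; simp
      have e1 : (ψ v) 1 = -v 1 := by rw [hψ, psi_apply]; simp
      simp only [col, hgtOf] at a1 a2
      rw [e0, e1]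
      omega
  have e0 : ψ '' {0} = {![1, 0]} := by
    rw [image_singleton, hψ, psi_apply]
    simp
  rw [eS, e0]
  -- Step 3: the targets agree inside the region
  refine congrArg _ (Subset.antisymm (HalfPlaneArm.openCrossing_mono'' subset_rfl (fun _ h _ => h) ?_)
    (HalfPlaneArm.openCrossing_mono'' subset_rfl (fun _ h _ => h) ?_))
  · rintro v ⟨w, hw, rfl⟩ hv
    rw [hc1, hh1] at hv ⊢
    obtain ⟨a1, a2⟩ := hv
    simp only [mem_setOf_eq, hψcol, hψhgt] at a2 ⊢
    rw [max_le_iff, abs_le] at a2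
    simp only [hT, mem_setOf_eq] at hw
    refine le_antisymm (max_le (abs_le.2 ⟨by omega, by omega⟩) (by omega)) ?_
    rcases hw with hw | hw | hw
    · exact le_max_of_le_right (by omega)
    · exact le_max_of_le_left (by rw [show 1 - (w 0 - w 1) - 1 = -(n : ℤ) by omega, abs_neg]; exact le_abs_self _)
    · exact le_max_of_le_left (by rw [show 1 - (w 0 - w 1) - 1 = (n : ℤ) by omega]; exact le_abs_self _)
  · intro v hv hv'
    rw [hc1, hh1] at hv hv'
    refine ⟨ψ v, ?_, hψψ v⟩
    obtain ⟨a1, a2⟩ := hv'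
    rw [max_le_iff, abs_le] at a2
    have hv : max |col v - 1| (hgtOf v - 1) = n := hv
    simp only [hT, mem_setOf_eq]
    have f0 : (ψ v) 0 = 1 - v 0 := by rw [hψ, psi_apply]; simp
    have f1 : (ψ v) 1 = -v 1 := by rw [hψ, psi_apply]; simp
    rw [f0, f1]
    simp only [col, hgtOf] at a1 a2 hv
    rcases max_eq_iff.1 hv with ⟨h1, -⟩ | ⟨h1, -⟩
    · rcases (abs_eq (by positivity : (0 : ℤ) ≤ n)).1 h1 with h2 | h2
      · right; right; omega
      · right; left; omega
    · left; omega

/-! ### Positivity of the diagonal one-arm probability -/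

/-- The downward column edges `{(0, -i), (0, -(i+1))}`, `i < n`. [folklore] -/
theorem downColumn_subset_edgeSet (n : ℕ) :
    (↑((Finset.range n).image fun i : ℕ => s((![0, -((i : ℤ) + 1)] : Site 2), ![0, -(i : ℤ)])) :
      Set (Sym2 (Site 2))) ⊆ (zdGraph 2).edgeSet := by
  intro e he
  rw [Finset.coe_image, Set.mem_image] at he
  obtain ⟨i, -, rfl⟩ := he
  have h : (![0, -(i : ℤ)] : Site 2) = ![0, -((i : ℤ) + 1)] + Pi.single 1 1 := by
    funext j; fin_cases j <;> simp
  rw [h]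
  exact single_edge_mem _ 1

/-- **The diagonal one-arm probability is positive**: if the `n` column edges below the origin are
open, `0` is joined to `(0, -n)` (where `v₀ + v₁ = -n`) inside the diagonal box, so the probability
is at least `2⁻ⁿ`. [folklore] -/
theorem real_diagArm_pos (n : ℕ) :
    0 < (bondPercolation (zdGraph 2) half).real
      {ω : BondConfig (Site 2) | ∃ y : Site 2, (y 0 + y 1 = -(n : ℤ) ∨ y 0 - y 1 = (n : ℤ) ∨ y 0 - y 1 = -(n : ℤ)) ∧
        ω ∈ openConnIn {v : Site 2 | v 0 + v 1 ≤ 1 ∧ -(n : ℤ) ≤ v 0 + v 1 ∧ -(n : ℤ) ≤ v 0 - v 1 ∧ v 0 - v 1 ≤ n} 0 y} := by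
  classical
  set S : Set (Site 2) := {v : Site 2 | v 0 + v 1 ≤ 1 ∧ -(n : ℤ) ≤ v 0 + v 1 ∧ -(n : ℤ) ≤ v 0 - v 1 ∧ v 0 - v 1 ≤ n}
    with hS
  set F : Finset (Sym2 (Site 2)) := (Finset.range n).image fun i : ℕ => s((![0, -((i : ℤ) + 1)] : Site 2), ![0, -(i : ℤ)])
    with hF
  have hprob := bondPercolation_real_setOf_subset (zdGraph 2) half F (downColumn_subset_edgeSet n)
  have hpos : 0 < (bondPercolation (zdGraph 2) half).real {ω | (F : Set (Sym2 (Site 2))) ⊆ ω} := by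
    rw [hprob]; exact pow_pos (by rw [coe_half]; norm_num) _
  refine hpos.trans_le (measureReal_mono (fun ω hω => ?_) (measure_ne_top _ _))
  have hω : (F : Set (Sym2 (Site 2))) ⊆ ω := hω
  -- the column sites
  have hmem : ∀ k : ℕ, k ≤ n → (![0, -(k : ℤ)] : Site 2) ∈ S := fun k hk => by
    simp only [hS, mem_setOf_eq, Matrix.cons_val_zero, Matrix.cons_val_one, Matrix.cons_val_fin_one]
    omega
  have hreach : ∀ k : ℕ, ∀ hk : k ≤ n,
      ((openGraph ω).induce S).Reachable ⟨![0, -((0 : ℕ) : ℤ)], hmem 0 (Nat.zero_le n)⟩ ⟨![0, -(k : ℤ)], hmem k hk⟩ := by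
    intro k
    induction k with
    | zero => intro hk; exact SimpleGraph.Reachable.refl _
    | succ k ih =>
      intro hk
      refine (ih (Nat.le_of_succ_le hk)).trans (SimpleGraph.Adj.reachable ?_)
      rw [SimpleGraph.induce_adj, openGraph_adj]
      refine ⟨hω ?_, ?_⟩
      · rw [hF, Finset.coe_image, Sym2.eq_swap]
        exact ⟨k, by simpa using Nat.lt_of_succ_le hk, by push_cast; rfl⟩
      · intro heq
        have := congr_fun heq 1
        simp at this
  have h0 : (![0, -((0 : ℕ) : ℤ)] : Site 2) = 0 := by funext j; fin_cases j <;> simp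
  refine ⟨![0, -(n : ℤ)], Or.inl (by simp), ?_⟩
  refine ⟨h0 ▸ hmem 0 (Nat.zero_le n), hmem n le_rfl, ?_⟩
  have := hreach n le_rfl
  convert this using 2
  · exact h0.symm

end HalfPlaneArm

end Literature.Probability.Percolation
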